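import Summits.BirchSwinnertonDyer.BirchSwinnertonDyer.Theorems.PrintX9RescalingCompactSelmerDivision
import Summits.BirchSwinnertonDyer.BirchSwinnertonDyer.Theorems.PrintX9RescalingCharIdealPow
import Summits.BirchSwinnertonDyer.BirchSwinnertonDyer.Theorems.RamifiedSevenEllipticUnitsKummerFamiliesSelmer
import Literature.NumberTheory.EllipticCurves.HeegnerModuleScalingDivisibilityProofs
import HarnessLib

/-!
# Rescaling the parametrisation by `p^a`: `ℋ_∞(p^a • F) = p^a · ℋ_∞(F)`, `I(ℋ_∞(p^a • F)) ⊆ (p^a)·I(ℋ_∞(F))`,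
# and the `∃ F`-typed Howard containment is insensitive to the `μ`-part (crux
# `PrintX9.HowardContainmentLightFrameOfPrint`, stmt-BirchSwinnertonDyer-25235, line
# `torsion-depth-light-ofprint`, stub `stub_depthPos_muPart`; part III of III)

Sequel (Summits side, `--supports stmt-BirchSwinnertonDyer-25235`) to the Literature proof files
`HeegnerModuleScalingProofs` (`ℋ̄_k(m • F) = m • ℋ̄_k(F)`; `ℋ_∞(m • F) = ℋ_∞(F)` for `p ∤ m`) and
`HeegnerModuleScalingDivisibilityProofs` (the sandwich `(C m) • ℋ_∞(F) ⊆ ℋ_∞(m • F) ⊆ ℋ_∞(F)`, any `m`),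
which leave the case `m = p^a` open («levelwise `p`-divisibility inside `𝔖_p` — not attempted»; supplied
by part I). Here:

* §4 `heegnerModuleLayer_le_compactSelmerOver` (`ℋ̄_k(F) ⊆ S_p(E/K_k)`), `heegnerModule_zsmul_pow_le`,
  `heegnerModule_zsmul_pow_eq`: **`ℋ_∞(p^a • F) = p^a · ℋ_∞(F)`** when `E(K_n)[p] = 0` along the tower.
* §6 `heegnerCharIdeal_zsmul_pow_le`: **`I(ℋ_∞(p^a • F)) ⊆ (p^a) · I(ℋ_∞(F))`** (multiplicativity of
  `char` on `0 → ℋ/p^aℋ → 𝔖/ℋ_∞(p^a • F) → 𝔖/ℋ_∞(F) → 0` and part II), and the PROMOTION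
  `sq_heegnerCharIdeal_zsmulSelf_le_of_localized`: `(p^m) · I(ℋ_∞(F))² ⊆ A ⟹ I(ℋ_∞(p^m • F))² ⊆ A`,
  packaged for the crux as `howardContainment_of_localized_family`: the `p`-LOCALIZED containment
  `(p^m) · I(ℋ_{F₀})² ⊆ char_Λ(X_tors)` for ONE Heegner family `F₀` (what CGLS 2022 Thm. 4.1.3
  "Moreover" gives after an envelope comparison `ℋ_{F₀} ⊆ Λκ_∞`) already yields
  `∃ F, I(ℋ_F)² ⊆ char_Λ(X_tors)` — the conclusion SHAPE of `PrintX9.HowardContainmentLightFrame`, which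
  quantifies `∃ F` over Heegner families carrying their own parametrisation datum `F.Dt` and therefore
  does not see the `μ`-part (CGLS 2022, Remark after Conj. A: «with `p` inverted the terms are invariant
  under isogenies»).

HONEST FRAMING: module/cohomology bookkeeping only; no named fact; nothing here proves the crux, Howard's
Theorem B, or BSD. The hypotheses left to the line are explicit and all PRINT: `𝔖` finitely generated
with `𝔖/ℋ_{F₀}` torsion (CGLS Thm. 4.1.3: `Λ`-rank one), a non-torsion element of `ℋ_{F₀}` (Cornut–Vatsal,
CGLS Thm. 4.1.1), `E(K_n)[p] = 0` along the tower ((irr_K) and `p`-group fixed points), and the envelope.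

References: B. Perrin-Riou, Bull. SMF 115 (1987) §1 p. 405 (`I(H_∞)`, `H_∞` «dépendant du choix de la
paramétrisation π»); B. Howard, Compositio 140 (2004) §1 Thm. B, §3.3 (`H_k`, `𝐇 = lim← H_k`);
F. Castella, G. Grossi, J. Lee, C. Skinner, Invent. Math. 227 (2022) Thm. 4.1.3, Rem. 4.1.4 and Remark
after Conj. A; NSW Ch. V §3 (multiplicativity of `char`).
-/

set_option linter.dupNamespace false
set_option autoImplicit false

noncomputable section

open scoped Classical Pointwise

universe u

open WeierstrassCurve Literature.NumberTheory.EllipticCurves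
  Literature.NumberTheory.EllipticCurves.ModularForms

namespace Summit.BirchSwinnertonDyer.BirchSwinnertonDyer.Theorems.PrintX9Rescaling

/-! ## §4 `ℋ_∞(p^a • F) = p^a · ℋ_∞(F)` -/

section HeegnerModulePow

variable {K : Type u} [Field K] [NumberField K] {N : ℕ} [NeZero N] {W : WeierstrassCurve ℚ}
  [W.IsElliptic] {p : ℕ} [Fact p.Prime] {κ : ZpExtension K p} {γ : Field.absoluteGaloisGroup K}
  {jbar : AlgebraicClosure K →+* ℂ}

/-- **The layer Heegner module lies in the compact Selmer group**: `ℋ̄_k(F) ⊆ S_p(E/K_k)` — its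
generators are `ℤ_p`-multiples of conjugates of Kummer families of `K_k`-rational points
(`IsKummerFamilyOver.conjPi`, `.mem_compactSelmerOver`, and the landed
`RamifiedSevenEllipticUnits.KummerFamiliesSelmer.padicPi_mem_compactSelmerOver`).
[cite: Howard2004HeegnerKolyvagin, §3.3 (H_k ⊂ E(K_k) ⊗ ℤ_p ↪ the Selmer group by the Kummer map)] -/
theorem heegnerModuleLayer_le_compactSelmerOver (γ : Field.absoluteGaloisGroup K)
    (F : HeegnerFamily N W K κ jbar) (k : ℕ) :
    heegnerModuleLayer γ F k ≤ (W.baseChange K).compactSelmerOver (κ.layerSubgroup k) p := by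
  refine (AddSubgroup.closure_le _).mpr ?_
  rintro v ⟨c, i, w, hw, d, hd, rfl⟩
  have hfix : ∀ σ ∈ κ.layerSubgroup k, σ • w = w := fun σ hσ ↦ F.smul_eq_of_mem_generators hw hσ
  have hdK : (W.baseChange K).IsKummerFamilyOver p (κ.layerSubgroup k) hfix d := fun n Q hQ ↦ hd n Q hQ
  exact RamifiedSevenEllipticUnits.KummerFamiliesSelmer.padicPi_mem_compactSelmerOver _ _ p c
    ((hdK.conjPi (γ ^ i)).mem_compactSelmerOver)

/-- **`ℋ_∞(p^a • F) ⊆ p^a · ℋ_∞(F)`** (the missing half of the sandwich at `m = p^a`): a generator `s` of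
`ℋ_∞(p^a • F)` has `proj_k s ∈ ℋ̄_k(p^a • F) = p^a • ℋ̄_k(F)` (`heegnerModuleLayer_zsmul`), so by division
in `𝔖` (§3, `E(K_n)[p] = 0`) `s = p^a • s'` with `proj_k s' ∈ ℋ̄_k(F)`, i.e. `s'` a generator of `ℋ_∞(F)`.
[cite: Howard2004HeegnerKolyvagin, §3.3 (H_k, 𝐇 = lim← H_k)] [cite: PerrinRiou1987BSMF, §1 p. 405 (H_∞ depends on the parametrisation π)] -/
theorem heegnerModule_zsmul_pow_le (D : (W.baseChange K).LambdaAdicSelmerData κ γ)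
    (F : HeegnerFamily N W K κ jbar) (Dt' : ModularParametrizationData W N) (a : ℕ)
    (hφ : ∀ τ, Dt'.φ τ = ((p : ℤ) ^ a) • F.Dt.φ τ)
    (hnt : ∀ n, ∀ P ∈ (W.baseChange K).fixedGeomPoints (κ.layerSubgroup n), (p : ℤ) • P = 0 → P = 0)
    {s : D.S} (hs : s ∈ heegnerModule D (F.zsmul Dt' ((p : ℤ) ^ a) hφ)) :
    ∃ s' ∈ heegnerModule D F, s = ((p : IwasawaAlgebra p) ^ a) • s' := by
  induction hs using Submodule.span_induction with
  | mem g hg =>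
    have hk : ∀ k, ∃ t ∈ heegnerModuleLayer γ F k, ((p : ℤ) ^ a) • t = D.proj k g := fun k ↦ by
      have := hg k
      rw [heegnerModuleLayer_zsmul, AddSubgroup.mem_map] at this
      obtain ⟨t, ht, hteq⟩ := this
      exact ⟨t, ht, by rw [← hteq, zsmulAddGroupHom_apply]⟩
    choose t ht hts using hk
    obtain ⟨s', hs', hs's⟩ := exists_proj_eq_and_pow_smul_eq D hnt a g t
      (fun n ↦ heegnerModuleLayer_le_compactSelmerOver γ F n (ht n)) hts
    exact ⟨s', Submodule.subset_span fun k ↦ (hs' k).symm ▸ ht k, hs's.symm⟩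
  | zero => exact ⟨0, Submodule.zero_mem _, (smul_zero _).symm⟩
  | add x y _ _ hx hy =>
    obtain ⟨x', hx', rfl⟩ := hx
    obtain ⟨y', hy', rfl⟩ := hy
    exact ⟨x' + y', Submodule.add_mem _ hx' hy', (smul_add _ _ _).symm⟩
  | smul c x _ hx =>
    obtain ⟨x', hx', rfl⟩ := hx
    exact ⟨c • x', Submodule.smul_mem _ c hx', by rw [smul_comm]⟩

/-- **`ℋ_∞(p^a • F) = p^a · ℋ_∞(F)`** as submodules of `𝔖`: the image of `ℋ_∞(F)` under multiplication
by `(p : Λ)^a`, i.e. the pointwise `(p : Λ)^a • ℋ_∞(F)` (`heegnerModule_zsmul_pow_le` and `C_smul_mem_heegnerModule_zsmul`).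
[cite: Howard2004HeegnerKolyvagin, §3.3 (𝐇 = lim← H_k)] [cite: PerrinRiou1987BSMF, §1 p. 405] -/
theorem heegnerModule_zsmul_pow_eq (D : (W.baseChange K).LambdaAdicSelmerData κ γ)
    (F : HeegnerFamily N W K κ jbar) (Dt' : ModularParametrizationData W N) (a : ℕ)
    (hφ : ∀ τ, Dt'.φ τ = ((p : ℤ) ^ a) • F.Dt.φ τ)
    (hnt : ∀ n, ∀ P ∈ (W.baseChange K).fixedGeomPoints (κ.layerSubgroup n), (p : ℤ) • P = 0 → P = 0) :
    heegnerModule D (F.zsmul Dt' ((p : ℤ) ^ a) hφ) =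
      ((p : IwasawaAlgebra p) ^ a) • heegnerModule D F := by
  apply le_antisymm
  · intro s hs
    obtain ⟨s', hs', rfl⟩ := heegnerModule_zsmul_pow_le D F Dt' a hφ hnt hs
    exact Submodule.smul_mem_pointwise_smul _ _ _ hs'
  · intro s hs
    obtain ⟨s', hs', rfl⟩ := (Submodule.mem_smul_pointwise_iff_exists _ _ _).1 hs
    rw [natCast_pow_eq_C]
    exact C_smul_mem_heegnerModule_zsmul D F Dt' _ hφ hs'

end HeegnerModulePow

/-! ## §6 `I(ℋ_∞(p^a • F)) ⊆ (p^a) · I(ℋ_∞(F))` and the promotion -/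

section Promotion

variable {K : Type u} [Field K] [NumberField K] {N : ℕ} [NeZero N] {W : WeierstrassCurve ℚ}
  [W.IsElliptic] {p : ℕ} [Fact p.Prime] {κ : ZpExtension K p} {γ : Field.absoluteGaloisGroup K}
  {jbar : AlgebraicClosure K →+* ℂ}

/-- **`I(ℋ_∞(p^a • F)) ⊆ (p^a) · I(ℋ_∞(F))`.** With `ℋ' = ℋ_∞(p^a • F) = p^a ℋ` (§4), the sequence
`0 → ℋ/p^aℋ → 𝔖/ℋ' → 𝔖/ℋ → 0` is exact, so `char(𝔖/ℋ') = char(ℋ/p^aℋ) · char(𝔖/ℋ)` (multiplicativity),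
and `char(ℋ/p^aℋ) ⊆ (p^a)` (§5: `ℋ` is finitely generated inside the Noetherian `𝔖`, has no `p`-torsion as
`𝔖` has none, and contains a non-torsion element). Hypotheses: `𝔖` finitely generated, `𝔖/ℋ_∞(F)` torsion,
`E(K_n)[p] = 0` along the tower, a non-torsion element of `ℋ_∞(F)`.
[cite: PerrinRiou1987BSMF, §1 p. 405 (I(H_∞); H_∞ depends on the parametrisation π)] [cite: NeukirchSchmidtWingberg2008, Ch. V §3 (multiplicativity of char)] -/
theorem heegnerCharIdeal_zsmul_pow_le (D : (W.baseChange K).LambdaAdicSelmerData κ γ)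
    (F : HeegnerFamily N W K κ jbar) (Dt' : ModularParametrizationData W N) (a : ℕ)
    (hφ : ∀ τ, Dt'.φ τ = ((p : ℤ) ^ a) • F.Dt.φ τ)
    [Module.Finite (IwasawaAlgebra p) D.S]
    (hnt : ∀ n, ∀ P ∈ (W.baseChange K).fixedGeomPoints (κ.layerSubgroup n), (p : ℤ) • P = 0 → P = 0)
    (htor : Module.IsTorsion (IwasawaAlgebra p) (D.S ⧸ heegnerModule D F))
    (hh : ∃ h ∈ heegnerModule D F, ∀ c : IwasawaAlgebra p, c • h = 0 → c = 0) :
    heegnerCharIdeal D (F.zsmul Dt' ((p : ℤ) ^ a) hφ) ≤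
      Ideal.span {(p : IwasawaAlgebra p) ^ a} * heegnerCharIdeal D F := by
  set H : Submodule (IwasawaAlgebra p) D.S := heegnerModule D F with hH
  set H' : Submodule (IwasawaAlgebra p) D.S := heegnerModule D (F.zsmul Dt' ((p : ℤ) ^ a) hφ) with hH'
  have hH'eq : H' = ((p : IwasawaAlgebra p) ^ a) • H := heegnerModule_zsmul_pow_eq D F Dt' a hφ hnt
  have hle : H' ≤ H := heegnerModule_zsmul_le D F Dt' _ hφ
  -- the module `ℋ/π^aℋ` and the map `f : ℋ/π^aℋ → 𝔖/ℋ'`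
  set Na : Submodule (IwasawaAlgebra p) H := ((p : IwasawaAlgebra p) ^ a) • (⊤ : Submodule (IwasawaAlgebra p) H) with hNa
  have hmemNa : ∀ m : H, m ∈ Na ↔ ∃ m' : H, m = ((p : IwasawaAlgebra p) ^ a) • m' := fun m ↦ by
    rw [hNa, Submodule.mem_smul_pointwise_iff_exists]
    exact ⟨fun ⟨m', _, h⟩ ↦ ⟨m', h.symm⟩, fun ⟨m', h⟩ ↦ ⟨m', Submodule.mem_top, h.symm⟩⟩
  have hmemH' : ∀ s : D.S, s ∈ H' ↔ ∃ m : H, s = ((p : IwasawaAlgebra p) ^ a) • (m : D.S) := fun s ↦ by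
    rw [hH'eq, Submodule.mem_smul_pointwise_iff_exists]
    constructor
    · rintro ⟨m, hm, rfl⟩; exact ⟨⟨m, hm⟩, rfl⟩
    · rintro ⟨m, rfl⟩; exact ⟨m, m.2, rfl⟩
  have hleNa : Na ≤ H'.comap H.subtype := by
    intro m hm
    obtain ⟨m', rfl⟩ := (hmemNa m).1 hm
    rw [Submodule.mem_comap, Submodule.subtype_apply, hmemH']
    exact ⟨m', by rw [Submodule.coe_smul]⟩
  let f : (H ⧸ Na) →ₗ[IwasawaAlgebra p] D.S ⧸ H' := Submodule.mapQ _ _ H.subtype hleNa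
  have hf : Function.Injective f := by
    rw [← LinearMap.ker_eq_bot, eq_bot_iff]
    intro x hx
    obtain ⟨m, rfl⟩ := Submodule.mkQ_surjective _ x
    rw [LinearMap.mem_ker, Submodule.mkQ_apply, Submodule.mapQ_apply, Submodule.Quotient.mk_eq_zero,
      Submodule.subtype_apply, hmemH'] at hx
    obtain ⟨m', hm'⟩ := hx
    rw [Submodule.mem_bot, Submodule.mkQ_apply, Submodule.Quotient.mk_eq_zero, hmemNa]
    refine ⟨m', Subtype.ext ?_⟩
    rw [Submodule.coe_smul, hm']
  let g : (D.S ⧸ H') →ₗ[IwasawaAlgebra p] D.S ⧸ H := Submodule.factor hle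
  have hg : Function.Surjective g := Submodule.factor_surjective hle
  have hfg : Function.Exact f g := by
    intro y
    obtain ⟨s, rfl⟩ := Submodule.mkQ_surjective _ y
    constructor
    · intro hy
      rw [Submodule.factor_mk, Submodule.mkQ_apply, Submodule.Quotient.mk_eq_zero] at hy
      exact ⟨Submodule.Quotient.mk ⟨s, hy⟩, rfl⟩
    · rintro ⟨x, hx⟩
      obtain ⟨m, rfl⟩ := Submodule.mkQ_surjective _ x
      rw [Submodule.mkQ_apply, Submodule.mapQ_apply, Submodule.subtype_apply, Submodule.mkQ_apply,
        Submodule.Quotient.eq] at hx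
      rw [Submodule.factor_mk, Submodule.mkQ_apply, Submodule.Quotient.mk_eq_zero]
      have := H.sub_mem m.2 (hle hx)
      rwa [sub_sub_cancel] at this
  have htor' : Module.IsTorsion (IwasawaAlgebra p) (D.S ⧸ H') :=
    isTorsion_quotient_heegnerModule_zsmul D F Dt' (pow_ne_zero _ (Int.natCast_ne_zero.mpr
      (Fact.out : p.Prime).ne_zero)) hφ htor
  haveI : Module.Finite (IwasawaAlgebra p) (D.S ⧸ H') := inferInstance
  have hmul := Module.charIdeal_eq_mul_of_exact htor' f g hf hg hfg
  -- `char(ℋ/π^aℋ) ⊆ (π^a)`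
  haveI : IsNoetherian (IwasawaAlgebra p) D.S := isNoetherian_of_isNoetherianRing_of_finite _ _
  haveI : Module.Finite (IwasawaAlgebra p) H := Module.IsNoetherian.finite _ _
  have hfreeH : ∀ m : H, (p : IwasawaAlgebra p) • m = 0 → m = 0 := fun m hm ↦
    Subtype.ext (eq_zero_of_natCast_smul_eq_zero D hnt (by
      rw [← Submodule.coe_smul, hm, Submodule.coe_zero]))
  have hMH : ∃ h : H, ∀ c : IwasawaAlgebra p, c • h = 0 → c = 0 := by
    obtain ⟨h, hhH, hh⟩ := hh
    refine ⟨⟨h, hhH⟩, fun c hc ↦ hh c ?_⟩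
    have := congrArg ((↑) : H → D.S) hc
    rwa [Submodule.coe_smul, Submodule.coe_zero] at this
  have hchar := charIdeal_quotient_pow_smul_le (p := p) (M := H) hfreeH hMH a
  change Module.charIdeal (IwasawaAlgebra p) (D.S ⧸ H') ≤ _
  rw [hmul]
  exact Ideal.mul_mono hchar le_rfl

/-- **The promotion (μ-absorption by rescaling).** If the `p`-LOCALIZED containment
`(p^m) · I(ℋ_∞(F))² ⊆ A` holds for a Heegner family `F` (with `𝔖` finitely generated, `𝔖/ℋ_∞(F)` torsion,
`E(K_n)[p] = 0` along the tower, `ℋ_∞(F)` not torsion), then the INTEGRAL containment `I(ℋ_∞(F'))² ⊆ A`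
holds for the rescaled family `F' = F.zsmulSelf (p^m)` (parametrisation `[p^m] ∘ φ`):
`I(ℋ_∞(F'))² ⊆ (p^{2m}) I(ℋ_∞(F))² ⊆ (p^m) I(ℋ_∞(F))² ⊆ A`.
[cite: CastellaGrossiLeeSkinner2022, Remark after Conjecture A (Intro: with p inverted the terms are invariant under isogenies) and Thm. 4.1.3 ("Moreover": divisibility in Λ[1/p])] [cite: PerrinRiou1987BSMF, §1 p. 405 (H_∞ depends on π)] -/
theorem sq_heegnerCharIdeal_zsmulSelf_le_of_localized (D : (W.baseChange K).LambdaAdicSelmerData κ γ)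
    (F : HeegnerFamily N W K κ jbar) [Module.Finite (IwasawaAlgebra p) D.S]
    (hnt : ∀ n, ∀ P ∈ (W.baseChange K).fixedGeomPoints (κ.layerSubgroup n), (p : ℤ) • P = 0 → P = 0)
    (htor : Module.IsTorsion (IwasawaAlgebra p) (D.S ⧸ heegnerModule D F))
    (hh : ∃ h ∈ heegnerModule D F, ∀ c : IwasawaAlgebra p, c • h = 0 → c = 0)
    {A : Ideal (IwasawaAlgebra p)} {m : ℕ}
    (hloc : Ideal.span {(p : IwasawaAlgebra p) ^ m} * heegnerCharIdeal D F ^ 2 ≤ A) :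
    heegnerCharIdeal D (F.zsmulSelf ((p : ℤ) ^ m)
        (pow_ne_zero _ (Int.natCast_ne_zero.mpr (Fact.out : p.Prime).ne_zero))) ^ 2 ≤ A := by
  have hm0 : ((p : ℤ) ^ m) ≠ 0 := pow_ne_zero _ (Int.natCast_ne_zero.mpr (Fact.out : p.Prime).ne_zero)
  have hle := heegnerCharIdeal_zsmul_pow_le D F (F.Dt.zsmul ((p : ℤ) ^ m) hm0) m (F.Dt.φ_zsmul hm0)
    hnt htor hh
  change heegnerCharIdeal D (F.zsmul (F.Dt.zsmul ((p : ℤ) ^ m) hm0) ((p : ℤ) ^ m) (F.Dt.φ_zsmul hm0)) ^ 2 ≤ A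
  refine le_trans (Ideal.pow_right_mono hle 2) (le_trans ?_ hloc)
  rw [mul_pow]
  exact Ideal.mul_mono_left (Ideal.pow_le_self two_ne_zero)

/-- **What the `∃ F`-typed Howard containment asks at `p ∣ h_K`, by name.** For any `Λ`-adic Selmer datum
`D`, Selmer-dual datum `X` and ONE Heegner family `F₀` at level `N` with the `p`-localized containment
`(p^m) · I(ℋ_{F₀})² ⊆ char_Λ(X_{Λ-tors})` (CGLS 2022 Thm. 4.1.3 "Moreover" after the envelope
`ℋ_{F₀} ⊆ Λκ_∞`), `𝔖` finitely generated with `𝔖/ℋ_{F₀}` torsion (rank one), a non-torsion element in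
`ℋ_{F₀}` (Cornut–Vatsal) and `E(K_n)[p] = 0` along the anticyclotomic tower: there is a Heegner family `F`
(namely `p^m • F₀`) with `I(ℋ_F)² ⊆ char_Λ(X_{Λ-tors})` — the conclusion shape of
`PrintX9.HowardContainmentLightFrame`. No `μ`-invariant input is used.
[cite: CastellaGrossiLeeSkinner2022, Thm. 4.1.3 and Rem. 4.1.4] [cite: Howard2004HeegnerKolyvagin, §1 Thm. B (c)] -/
theorem howardContainment_of_localized_family (D : (W.baseChange K).LambdaAdicSelmerData κ γ)
    (X : (W.baseChange K).SelmerDualData κ γ) (F₀ : HeegnerFamily N W K κ jbar) (m : ℕ)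
    (hfin : Module.Finite (IwasawaAlgebra p) D.S)
    (hnt : ∀ n, ∀ P ∈ (W.baseChange K).fixedGeomPoints (κ.layerSubgroup n), (p : ℤ) • P = 0 → P = 0)
    (htor : Module.IsTorsion (IwasawaAlgebra p) (D.S ⧸ heegnerModule D F₀))
    (hh : ∃ h ∈ heegnerModule D F₀, ∀ c : IwasawaAlgebra p, c • h = 0 → c = 0)
    (hloc : Ideal.span {(p : IwasawaAlgebra p) ^ m} * heegnerCharIdeal D F₀ ^ 2 ≤
      Module.charIdeal (IwasawaAlgebra p) (Submodule.torsion (IwasawaAlgebra p) X.X)) :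
    ∃ F : HeegnerFamily N W K κ jbar, heegnerCharIdeal D F ^ 2 ≤
      Module.charIdeal (IwasawaAlgebra p) (Submodule.torsion (IwasawaAlgebra p) X.X) :=
  ⟨_, sq_heegnerCharIdeal_zsmulSelf_le_of_localized D F₀ hnt htor hh hloc⟩

end Promotion

end Summit.BirchSwinnertonDyer.BirchSwinnertonDyer.Theorems.PrintX9Rescaling

end
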